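import Summits.SmoothPoincare4.SmoothPoincare4.Theorems.ConvexBisectionAcyclicBisectionExistsHgapTwistGlue
import Literature.Topology.FourManifolds.KnotFraming
import Literature.Topology.FourManifolds.PlanarLefschetzBodyJordan
import HarnessLib

/-!
# N1 ▸ `node_N1_move` ▸ (d) N1-mono (the deep-belt monodromy model), brick H4-3:
# THE BELT CHART OF `∂X₀` THROUGH `G₀` — belt coordinates `(u, m)` around the belt circle of a handle
(wave 7, crux stmt-SmoothPoincare4-10508, line `modp-braid-orbits`, registered stub `stub_M2geo` (N1) ▸
`node_N1_move` ▸ sub-node (d); registered sub-goal `helper_beltChart_cover`)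

In the telescope of `node_N1_move` (`bX` a boundary datum of the ORIGINAL piece `X₀`, `G₀ : X₀ ≅ X`, data `D`
of `X` over the attaching maps `h`), the belt tube `β♭ := (beltMap D k).boundaryTube` of handle `k` lives in
the canonical boundary `∂X`; read on `∂X₀` through the restriction `T := ∂(G₀⁻¹)` of `G₀⁻¹` to the boundaries
(`BoundaryData.restrictDiffeomorph`) it is THE BELT CHART

    B (u, m) := T (β♭ (e^{2πiu}, m)) ∈ ∂X₀,   u ∈ ℝ, ‖m‖ < 1,

the coordinates in which (d) (`work/stubs/H4H7_interface.lean`) is proved (pieces (d3)–(d8) of H4-REPORT §4):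
* `G₀ (bX.incl (B (u, m))) = β♭ (e^{2πiu}, m)` (§1); the CORE `m = 0` is the belt circle
  `D.jB k (0, 0, e^{2πiu})`, a deep point (off `range D.jA`); the PUNCTURED chart is seam: for `m = r v`,
  `0 < r < 1`, `G₀ (bX.incl (B (u, r v))) = D.jA (h k (depthLine v (r e^{2πiu}) 0))` — core angle and fibre
  direction EXCHANGED (G2 `coe_belt_boundaryTube_polar`);
* `B` is smooth on `ℝ × ball 0 1`, `1`-periodic, injective on `[0,1) × ball 0 1`, an immersion (§2);
* COVER (registered `helper_beltChart_cover`): every `y ∈ ∂X₀` with `G₀ (bX.incl y)` in the (open) range of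
  the belt map — in particular every point near the belt circle — is `B (u, m)` with `‖m‖ < 1` (§3).

Everything is proved; no named facts, no `sorry`.  References: A. A. Kosinski, *Differential Manifolds*
(1993), VI §6 [Kosinski1993]; J. Milnor, *Lectures on the h-cobordism theorem* (1965), §3
[MilnorHCobordism1965].
-/

noncomputable section

set_option linter.dupNamespace false

open scoped Manifold ContDiff Topology
open Set Function Metric
open Literature.Topology.FourManifolds Literature.Topology.FourManifolds.HandleAttachingMap
  Literature.Topology.FourManifolds.LefschetzBase

namespace Summit.SmoothPoincare4.SmoothPoincare4.Theorems.AcyclicBisectionExists.ModpBraidOrbits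

variable {g n : ℕ} {h : Fin n → HandleAttachingMap 3 2 (Base g)}
  {X₀ : Type} [TopologicalSpace X₀] [ChartedSpace (EuclideanHalfSpace 4) X₀]
  {X : Type} [TopologicalSpace X] [ChartedSpace (EuclideanHalfSpace 4) X] [IsManifold (𝓡∂ 4) ∞ X]
  (bX : BoundaryData (𝓡∂ 4) X₀ (𝓡 3)) (G₀ : X₀ ≃ₘ⟮𝓡∂ 4, 𝓡∂ 4⟯ X)
  (D : MultiAttachmentData h (𝓡∂ 4) X) (k : Fin n)

/-! ## §1 The belt chart on points -/

/-- Through `T := ∂(G₀⁻¹)`, a point `z ∈ ∂X` is read on `∂X₀` over itself: `G₀ (bX.incl (T z)) = z`.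
[folklore] -/
theorem G₀_incl_restrict (z : (BoundaryManifold.boundaryData 3 X).carrier) :
    G₀ (bX.incl ((BoundaryManifold.boundaryData 3 X).restrictDiffeomorph bX G₀.symm z)) =
      (BoundaryManifold.boundaryData 3 X).incl z := by
  rw [BoundaryData.incl_restrictDiffeomorph, Diffeomorph.apply_symm_apply]

/-- **The core of the belt chart is the belt circle**: `G₀ (bX.incl (B (u, 0))) = D.jB k (0, 0, e^{2πiu})`.
[cite: MilnorHCobordism1965, §3] -/
theorem beltChart_zero (θ : sphere (0 : EuclideanSpace ℝ (Fin 2)) 1) :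
    G₀ (bX.incl ((BoundaryManifold.boundaryData 3 X).restrictDiffeomorph bX G₀.symm
      ((beltMap D k).boundaryTube.toHomeo (θ, (0 : EuclideanSpace ℝ (Fin 2)))))) =
      D.jB k (beltCirclePt θ) := by
  rw [G₀_incl_restrict]
  show (((beltMap D k).boundaryTube.toHomeo (θ, (0 : EuclideanSpace ℝ (Fin 2))) :
    ↥((𝓡∂ 4).boundary X)) : X) = _
  rw [HandleAttachingMap.coe_boundaryTube_apply, depthLine_zero_zero]
  exact attachingCircle_beltMap D k θ

/-- **The core of the belt chart is deep**: it is not a point of the base piece. [cite: Kosinski1993, VI §6] -/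
theorem beltChart_zero_not_mem_range (θ : sphere (0 : EuclideanSpace ℝ (Fin 2)) 1) :
    G₀ (bX.incl ((BoundaryManifold.boundaryData 3 X).restrictDiffeomorph bX G₀.symm
      ((beltMap D k).boundaryTube.toHomeo (θ, (0 : EuclideanSpace ℝ (Fin 2)))))) ∉ range D.jA := by
  rw [beltChart_zero]
  rintro ⟨a, ha⟩
  exact jA_ne_jB_beltCirclePt D k a θ ha

/-- **The punctured belt chart is seam, with core angle and fibre direction exchanged**: for `0 < r < 1`
and unit `v`, `G₀ (bX.incl (B (θ, r v))) = D.jA (h k (depthLine v (r θ) 0))`. [cite: Kosinski1993, VI §6] -/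
theorem beltChart_polar (v θ : sphere (0 : EuclideanSpace ℝ (Fin 2)) 1) {r : ℝ} (hr0 : 0 < r) (hr1 : r < 1) :
    G₀ (bX.incl ((BoundaryManifold.boundaryData 3 X).restrictDiffeomorph bX G₀.symm
      ((beltMap D k).boundaryTube.toHomeo (θ, r • (v : EuclideanSpace ℝ (Fin 2)))))) =
      D.jA ⟨(h k).toFun (depthLine v (r • (θ : EuclideanSpace ℝ (Fin 2))) 0),
        BeltPageClause.apply_mem_coresComplement_of_lamSq_ne_one D.disjoint k _
          (lamSq_depthLine_radial_ne_one v θ hr0 hr1)⟩ := by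
  rw [G₀_incl_restrict]
  exact coe_belt_boundaryTube_polar D k v θ hr0 hr1

/-- Every punctured belt-chart point is a seam point. [cite: Kosinski1993, VI §6] -/
theorem beltChart_mem_range {m : EuclideanSpace ℝ (Fin 2)} (hm0 : m ≠ 0) (hm1 : ‖m‖ < 1)
    (θ : sphere (0 : EuclideanSpace ℝ (Fin 2)) 1) :
    G₀ (bX.incl ((BoundaryManifold.boundaryData 3 X).restrictDiffeomorph bX G₀.symm
      ((beltMap D k).boundaryTube.toHomeo (θ, m)))) ∈ range D.jA := by
  have hn : ‖m‖ ≠ 0 := norm_ne_zero_iff.2 hm0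
  have hvmem : (‖m‖⁻¹ : ℝ) • m ∈ sphere (0 : EuclideanSpace ℝ (Fin 2)) 1 := by
    rw [mem_sphere_zero_iff_norm, norm_smul, norm_inv, norm_norm, inv_mul_cancel₀ hn]
  have e : m = ‖m‖ • (((⟨_, hvmem⟩ : sphere (0 : EuclideanSpace ℝ (Fin 2)) 1) : EuclideanSpace ℝ (Fin 2))) := by
    show m = ‖m‖ • ((‖m‖⁻¹ : ℝ) • m)
    rw [smul_smul, mul_inv_cancel₀ hn, one_smul]
  rw [e, beltChart_polar bX G₀ D k ⟨_, hvmem⟩ θ (norm_pos_iff.2 hm0) hm1]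
  exact mem_range_self _

/-! ## §2 Regularity of the belt chart -/

/-- The source map `(u, m) ↦ (e^{2πiu}, m)` of the belt chart is smooth. [folklore] -/
theorem contMDiff_circlePt_prod :
    ContMDiff 𝓘(ℝ, ℝ × EuclideanSpace ℝ (Fin 2)) ((𝓡 1).prod 𝓘(ℝ, EuclideanSpace ℝ (Fin 2))) ∞
      (fun p : ℝ × EuclideanSpace ℝ (Fin 2) => ((circlePt p.1, p.2) :
        sphere (0 : EuclideanSpace ℝ (Fin 2)) 1 × EuclideanSpace ℝ (Fin 2))) :=
  (contMDiff_circlePt.comp contDiff_fst.contMDiff).prodMk contDiff_snd.contMDiff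

/-- **The belt chart is smooth** on `ℝ × ball 0 1`. [cite: Kosinski1993, VI §6] -/
theorem contMDiffOn_beltChart :
    ContMDiffOn 𝓘(ℝ, ℝ × EuclideanSpace ℝ (Fin 2)) (𝓡 3) ∞
      (fun p : ℝ × EuclideanSpace ℝ (Fin 2) =>
        (BoundaryManifold.boundaryData 3 X).restrictDiffeomorph bX G₀.symm
          ((beltMap D k).boundaryTube.toHomeo (circlePt p.1, p.2)))
      (univ ×ˢ ball (0 : EuclideanSpace ℝ (Fin 2)) 1) := by
  have h1 := (beltMap D k).boundaryTube.contMDiffOn_toHomeo.comp contMDiff_circlePt_prod.contMDiffOn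
    (fun (p : ℝ × EuclideanSpace ℝ (Fin 2)) (hp : p ∈ univ ×ˢ ball (0 : EuclideanSpace ℝ (Fin 2)) 1) =>
      (beltMap D k).boundaryTube.mem_source_iff.2 (mem_ball_zero_iff.1 hp.2))
  exact ((BoundaryManifold.boundaryData 3 X).restrictDiffeomorph bX G₀.symm).contMDiff.comp_contMDiffOn h1

/-- **The belt chart is injective** on `[0,1) × ball 0 1` (and `1`-periodic in `u`). [cite: Kosinski1993, VI §6] -/
theorem injOn_beltChart :
    InjOn (fun p : ℝ × EuclideanSpace ℝ (Fin 2) =>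
        (BoundaryManifold.boundaryData 3 X).restrictDiffeomorph bX G₀.symm
          ((beltMap D k).boundaryTube.toHomeo (circlePt p.1, p.2)))
      (Ico (0 : ℝ) 1 ×ˢ ball (0 : EuclideanSpace ℝ (Fin 2)) 1) := by
  rintro ⟨u, m⟩ ⟨hu, hm⟩ ⟨u', m'⟩ ⟨hu', hm'⟩ hBB
  have h1 := ((BoundaryManifold.boundaryData 3 X).restrictDiffeomorph bX G₀.symm).injective hBB
  have h2 := (beltMap D k).boundaryTube.toHomeo.injOn
    ((beltMap D k).boundaryTube.mem_source_iff.2 (mem_ball_zero_iff.1 hm))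
    ((beltMap D k).boundaryTube.mem_source_iff.2 (mem_ball_zero_iff.1 hm')) h1
  simp only [Prod.mk.injEq] at h2
  exact Prod.ext (circlePt_injOn_Ico hu hu' h2.1) h2.2

/-- The belt chart is `1`-periodic in `u`. [folklore] -/
theorem beltChart_add_one (u : ℝ) (m : EuclideanSpace ℝ (Fin 2)) :
    (BoundaryManifold.boundaryData 3 X).restrictDiffeomorph bX G₀.symm
        ((beltMap D k).boundaryTube.toHomeo (circlePt (u + 1), m)) =
      (BoundaryManifold.boundaryData 3 X).restrictDiffeomorph bX G₀.symm
        ((beltMap D k).boundaryTube.toHomeo (circlePt u, m)) := by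
  rw [circlePt_add_one]

/-- **The belt chart is an immersion**: its differential is injective at every `(u, m)`, `‖m‖ < 1`.
[cite: Kosinski1993, VI §6] -/
theorem injective_mfderiv_beltChart (u : ℝ) {m : EuclideanSpace ℝ (Fin 2)} (hm : ‖m‖ < 1) :
    Injective (mfderiv 𝓘(ℝ, ℝ × EuclideanSpace ℝ (Fin 2)) (𝓡 3)
      (fun p : ℝ × EuclideanSpace ℝ (Fin 2) =>
        (BoundaryManifold.boundaryData 3 X).restrictDiffeomorph bX G₀.symm
          ((beltMap D k).boundaryTube.toHomeo (circlePt p.1, p.2))) (u, m)) := by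
  set T := (BoundaryManifold.boundaryData 3 X).restrictDiffeomorph bX G₀.symm with hT
  set Φ := (beltMap D k).boundaryTube with hΦ
  set j : ℝ × EuclideanSpace ℝ (Fin 2) → sphere (0 : EuclideanSpace ℝ (Fin 2)) 1 × EuclideanSpace ℝ (Fin 2) :=
    fun p => (circlePt p.1, p.2) with hj
  have hq : j (u, m) ∈ Φ.toHomeo.source := Φ.mem_source_iff.2 hm
  have hjd : MDifferentiableAt 𝓘(ℝ, ℝ × EuclideanSpace ℝ (Fin 2)) ((𝓡 1).prod 𝓘(ℝ, EuclideanSpace ℝ (Fin 2))) j (u, m) :=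
    contMDiff_circlePt_prod.mdifferentiableAt (by simp)
  have hΦd : MDifferentiableAt ((𝓡 1).prod 𝓘(ℝ, EuclideanSpace ℝ (Fin 2))) (𝓡 3) Φ.toHomeo (j (u, m)) :=
    (Φ.contMDiffAt_toHomeo hq).mdifferentiableAt (by simp)
  have hTd : MDifferentiableAt (𝓡 3) (𝓡 3) T (Φ.toHomeo (j (u, m))) := T.contMDiff.mdifferentiableAt (by simp)
  have e : (fun p : ℝ × EuclideanSpace ℝ (Fin 2) => T (Φ.toHomeo (circlePt p.1, p.2))) = (T ∘ Φ.toHomeo) ∘ j := rfl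
  rw [e, mfderiv_comp (u, m) (hTd.comp _ hΦd) hjd, mfderiv_comp (j (u, m)) hTd hΦd]
  -- the three differentials are injective
  have hinjT : Injective (mfderiv (𝓡 3) (𝓡 3) T (Φ.toHomeo (j (u, m)))) :=
    (T.mfderivToContinuousLinearEquiv (by simp) (Φ.toHomeo (j (u, m)))).injective
  have hinjΦ := Φ.injective_mfderiv_toHomeo hq
  have hinjj : Injective (mfderiv 𝓘(ℝ, ℝ × EuclideanSpace ℝ (Fin 2))
      ((𝓡 1).prod 𝓘(ℝ, EuclideanSpace ℝ (Fin 2))) j (u, m)) := by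
    -- a local left inverse `L (ψ, m) := (ang ψ, m)` of `j` near `(u, m)`
    obtain ⟨ang, hang, heq⟩ := exists_local_section_circlePt u
    let L : sphere (0 : EuclideanSpace ℝ (Fin 2)) 1 × EuclideanSpace ℝ (Fin 2) → ℝ × EuclideanSpace ℝ (Fin 2) :=
      fun q => (ang q.1, q.2)
    have hL : ContMDiffAt ((𝓡 1).prod 𝓘(ℝ, EuclideanSpace ℝ (Fin 2))) 𝓘(ℝ, ℝ × EuclideanSpace ℝ (Fin 2)) ∞
        L (j (u, m)) :=
      (hang.comp (j (u, m)) contMDiffAt_fst).prodMk_space contMDiffAt_snd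
    have hLd : MDifferentiableAt ((𝓡 1).prod 𝓘(ℝ, EuclideanSpace ℝ (Fin 2))) 𝓘(ℝ, ℝ × EuclideanSpace ℝ (Fin 2))
        L (j (u, m)) := hL.mdifferentiableAt (by simp)
    have hev : (L ∘ j) =ᶠ[𝓝 (u, m)] id := by
      have h1 : ∀ᶠ p : ℝ × EuclideanSpace ℝ (Fin 2) in 𝓝 (u, m), ang (circlePt p.1) = p.1 :=
        (continuousAt_fst (p := (u, m))).eventually heq
      exact h1.mono fun p hp => Prod.ext hp rfl
    have h1 : mfderiv 𝓘(ℝ, ℝ × EuclideanSpace ℝ (Fin 2)) 𝓘(ℝ, ℝ × EuclideanSpace ℝ (Fin 2)) (L ∘ j) (u, m) =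
        (mfderiv ((𝓡 1).prod 𝓘(ℝ, EuclideanSpace ℝ (Fin 2))) 𝓘(ℝ, ℝ × EuclideanSpace ℝ (Fin 2)) L (j (u, m))).comp
          (mfderiv 𝓘(ℝ, ℝ × EuclideanSpace ℝ (Fin 2)) ((𝓡 1).prod 𝓘(ℝ, EuclideanSpace ℝ (Fin 2))) j (u, m)) :=
      mfderiv_comp (u, m) hLd hjd
    have h2 : mfderiv 𝓘(ℝ, ℝ × EuclideanSpace ℝ (Fin 2)) 𝓘(ℝ, ℝ × EuclideanSpace ℝ (Fin 2)) (L ∘ j) (u, m) =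
        mfderiv 𝓘(ℝ, ℝ × EuclideanSpace ℝ (Fin 2)) 𝓘(ℝ, ℝ × EuclideanSpace ℝ (Fin 2)) id (u, m) :=
      hev.mfderiv_eq
    rw [mfderiv_id] at h2
    intro a b hab
    have := congrArg (mfderiv ((𝓡 1).prod 𝓘(ℝ, EuclideanSpace ℝ (Fin 2))) 𝓘(ℝ, ℝ × EuclideanSpace ℝ (Fin 2))
      L (j (u, m))) hab
    rw [← ContinuousLinearMap.comp_apply, ← ContinuousLinearMap.comp_apply, ← h1, h2] at this
    exact this
  exact (hinjT.comp hinjΦ).comp hinjj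

/-! ## §3 The belt chart covers a neighbourhood of the belt circle -/

omit [IsManifold (𝓡∂ 4) ∞ X] in
/-- The range of the belt map is an open set of `X` containing the belt circle. [cite: Kosinski1993, VI §6] -/
theorem jB_beltCirclePt_mem_range_beltMap (θ : sphere (0 : EuclideanSpace ℝ (Fin 2)) 1) :
    D.jB k (beltCirclePt θ) ∈ range (beltMap D k).toFun := by
  rw [← attachingCircle_beltMap D k θ]
  exact ⟨_, rfl⟩

/-- **The belt chart covers the belt region**: every `y ∈ ∂X₀` with `G₀ (bX.incl y)` in the range of the belt map
of handle `k` is `B (u, m)` with `‖m‖ < 1`. [cite: Kosinski1993, VI §6] -/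
theorem exists_beltChart_eq (y : bX.carrier) (hy : G₀ (bX.incl y) ∈ range (beltMap D k).toFun) :
    ∃ (u : ℝ) (m : EuclideanSpace ℝ (Fin 2)), ‖m‖ < 1 ∧
      (BoundaryManifold.boundaryData 3 X).restrictDiffeomorph bX G₀.symm
        ((beltMap D k).boundaryTube.toHomeo (circlePt u, m)) = y := by
  set T := (BoundaryManifold.boundaryData 3 X).restrictDiffeomorph bX G₀.symm with hT
  set z : ↥((𝓡∂ 4).boundary X) := T.symm y with hz
  have hzX : (z : X) = G₀ (bX.incl y) := by
    have e := G₀_incl_restrict bX G₀ z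
    rw [hz, Diffeomorph.apply_symm_apply] at e
    rw [BoundaryManifold.boundaryData_incl] at e
    exact e.symm
  have hzt : z ∈ (beltMap D k).boundaryTube.toHomeo.target := by
    rw [HandleAttachingMap.mem_boundaryTube_target_iff, hzX]
    exact hy
  set q := (beltMap D k).boundaryTube.toHomeo.symm z with hq
  have hqs : q ∈ (beltMap D k).boundaryTube.toHomeo.source := (beltMap D k).boundaryTube.toHomeo.map_target hzt
  have hqz : (beltMap D k).boundaryTube.toHomeo q = z := (beltMap D k).boundaryTube.toHomeo.right_inv hzt
  refine ⟨angA q.1, q.2, (beltMap D k).boundaryTube.mem_source_iff.1 (by rw [Prod.mk.eta]; exact hqs), ?_⟩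
  rw [circlePt_angA, Prod.mk.eta, hqz, hz, Diffeomorph.apply_symm_apply]

/-- **Sub-goal `helper_beltChart_cover` of stub `stub_M2geo`** (N1 ▸ `node_N1_move` ▸ (d) N1-mono, brick H4-3;
wave 7, lead c5).  THE BELT CHART OF `∂X₀`: for the telescope of `node_N1_move` and a handle `k`, the map
`(u, m) ↦ B (u, m) := ∂(G₀⁻¹) (β♭ (e^{2πiu}, m))` (`β♭` the belt tube of `beltMap D k`) satisfies: its core `m = 0` is
read in `X` as the belt-circle point `D.jB k (beltCirclePt e^{2πiu})`, which is off `range D.jA`; its punctured part is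
seam (`0 < ‖m‖ < 1 ⇒ G₀ (bX.incl (B (u,m))) ∈ range D.jA`); it is injective on `[0,1) × ball 0 1`; and it COVERS: every
`y ∈ ∂X₀` whose image `G₀ (bX.incl y)` lies in the range of the belt map is some `B (u, m)`, `‖m‖ < 1`.
[cite: Kosinski1993, VI §6] -/
theorem helper_beltChart_cover : ∀ (g n : ℕ) (h : Fin n → Literature.Topology.FourManifolds.HandleAttachingMap 3 2 (Literature.Topology.FourManifolds.LefschetzBase.Base g)) (X₀ : Type) [TopologicalSpace X₀] [ChartedSpace (EuclideanHalfSpace 4) X₀] (X : Type) [TopologicalSpace X] [ChartedSpace (EuclideanHalfSpace 4) X] [IsManifold (𝓡∂ 4) ∞ X] (bX : Literature.Topology.FourManifolds.BoundaryData (𝓡∂ 4) X₀ (𝓡 3)) (G₀ : X₀ ≃ₘ⟮𝓡∂ 4, 𝓡∂ 4⟯ X) (D : Literature.Topology.FourManifolds.HandleAttachingMap.MultiAttachmentData h (𝓡∂ 4) X) (k : Fin n), (∀ θ : Metric.sphere (0 : EuclideanSpace ℝ (Fin 2)) 1, G₀ (bX.incl ((Literature.Topology.FourManifolds.BoundaryManifold.boundaryData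 3 X).restrictDiffeomorph bX G₀.symm ((Summit.SmoothPoincare4.SmoothPoincare4.Theorems.AcyclicBisectionExists.ModpBraidOrbits.beltMap D k).boundaryTube.toHomeo (θ, (0 : EuclideanSpace ℝ (Fin 2)))))) = D.jB k (Summit.SmoothPoincare4.SmoothPoincare4.Theorems.AcyclicBisectionExists.ModpBraidOrbits.beltCirclePt θ) ∧ G₀ (bX.incl ((Literature.Topology.FourManifolds.BoundaryManifold.boundaryData 3 X).restrictDiffeomorph bX G₀.symm ((Summit.SmoothPoincare4.SmoothPoincare4.Theorems.AcyclicBisectionExists.ModpBraidOrbits.beltMap D k).boundaryTube.toHomeo (θ, (0 : EuclideanSpace ℝ (Fin 2)))))) ∉ Set.range D.jA) ∧ (∀ (θ : Metric.sphere (0 : EuclideanSpace ℝ (Fin 2)) 1) (m : EuclideanSpace ℝ (Fin 2)), m ≠ 0 → ‖m‖ < 1 → G₀ (bX.incl ((Literature.Topology.FourManifolds.BoundaryManifold.boundaryData 3 X).restrictDiffeomorph bX G₀.symm ((Summit.SmoothPoincare4.SmoothPoincare4.Theorems.AcyclicBisectionExists.ModpBraidOrbits.beltMap D k).boundaryTube.toHomeo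 (θ, m)))) ∈ Set.range D.jA) ∧ Set.InjOn (fun p : ℝ × EuclideanSpace ℝ (Fin 2) => (Literature.Topology.FourManifolds.BoundaryManifold.boundaryData 3 X).restrictDiffeomorph bX G₀.symm ((Summit.SmoothPoincare4.SmoothPoincare4.Theorems.AcyclicBisectionExists.ModpBraidOrbits.beltMap D k).boundaryTube.toHomeo (Literature.Topology.FourManifolds.circlePt p.1, p.2))) (Set.Ico (0 : ℝ) 1 ×ˢ Metric.ball (0 : EuclideanSpace ℝ (Fin 2)) 1) ∧ (∀ y : bX.carrier, G₀ (bX.incl y) ∈ Set.range (Summit.SmoothPoincare4.SmoothPoincare4.Theorems.AcyclicBisectionExists.ModpBraidOrbits.beltMap D k).toFun → ∃ (u : ℝ) (m : EuclideanSpace ℝ (Fin 2)), ‖m‖ < 1 ∧ (Literature.Topology.FourManifolds.BoundaryManifold.boundaryData 3 X).restrictDiffeomorph bX G₀.symm ((Summit.SmoothPoincare4.SmoothPoincare4.Theorems.AcyclicBisectionExists.ModpBraidOrbits.beltMap D k).boundaryTube.toHomeo (Literature.Topology.FourManifolds.circlePt u, m)) = y) := by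
  intro g n h X₀ _ _ X _ _ _ bX G₀ D k
  exact ⟨fun θ => ⟨beltChart_zero bX G₀ D k θ, beltChart_zero_not_mem_range bX G₀ D k θ⟩,
    fun θ m hm0 hm1 => beltChart_mem_range bX G₀ D k hm0 hm1 θ, injOn_beltChart bX G₀ D k,
    fun y hy => exists_beltChart_eq bX G₀ D k y hy⟩

end Summit.SmoothPoincare4.SmoothPoincare4.Theorems.AcyclicBisectionExists.ModpBraidOrbits

end
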